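import Summits.AnomalousDissipation.AnomalousDissipation.Theorems.SolenoidalFractalHomogenisationLagrangianStepSidebandXResidualBound
import Summits.AnomalousDissipation.AnomalousDissipation.Theorems.SolenoidalFractalHomogenisationLagrangianStepSidebandXSlowAveragingWeighted
import Summits.AnomalousDissipation.AnomalousDissipation.Theorems.SolenoidalFractalHomogenisationLagrangianStepSidebandXV0RPrep
import Summits.AnomalousDissipation.AnomalousDissipation.Theorems.SolenoidalFractalHomogenisationLagrangianStepSidebandXRepack
import Summits.AnomalousDissipation.AnomalousDissipation.Theorems.SolenoidalFractalHomogenisationLagrangianStepSidebandXCurrency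
import Summits.AnomalousDissipation.AnomalousDissipation.Theorems.SolenoidalFractalHomogenisationLagrangianStepCellClauseCutsFamily
import HarnessLib

/-!
# K1L_D `LagrangianRenormalisationStepDesign` (stmt-AnomalousDissipation-27980): THE REGISTERED STUB `stub_D1_V0R` (ruling D27-1) — clause (i)
# (the D1 residue certificate) ⇒ the guarded slow-vector clause (ii) for the exact width-`B₁` family `ΨB₁ a`, BY NAME
# (`--kind proof --supports stmt-AnomalousDissipation-27980`)

Summits-side theorem file of route `SolenoidalFractalHomogenisation` (prover seat `ad-k1l-cellLawV-w1` g8; 0 sorry, no defs, no named facts).  The statement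
is the registered v22–v26 text of `stub_D1_V0R` VERBATIM (skeleton `Cruxes/LagrangianRenormalisationStep/Lines/onelevel_v26.lean`).  Proof = the sideband
architecture of the w1 lineage (g5–g8), assembled: with `c := 1/a` the clause's effective tensor is `(1/n²)•(𝔸 + (1/ν)•Ψ⋆_ν((1/ν)•𝔸))`
(`…V0RPrep.effTensor_eq`); the clause's left side is `2‖x(t) − e^{−tḠ}x(0)‖²` (`…Currency.ae_two_sum_modeCoeff_sub_eq`, `Ḡ = effGenC … ℓ r₁`); the slow
mode is averaged with weighted-`L¹` forcing (`…SlowAveragingWeighted.norm_modeRep_sub_exp_le_weighted`, coercivity of `Ḡ` from the residue hypothesis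
through `…V0RPrep.effGenC_clause_coercive`, a priori bound `M = √E₀`); the forcing budget is `…ResidualBound.forcing_integral_le_single` (box `R0 ν`);
and the scalar repackaging `…Repack.master_le_half_clause` (with `…RhoBound.sqrt_rho_le`) turns the master estimate into HALF the clause bound with
`σ = 1`, `ν₀ = νB₁`, `K = 3 + 96A_N²C_f²Λ²/(π⁴lo²)` and an explicit `ν`-free `C`.  Infrastructure for route-1's rung F-D1.A0; NOT a proof of K1L_D, of the
crux, or of anomalous dissipation.
-/

set_option linter.dupNamespace false

noncomputable section

namespace Summit.AnomalousDissipation.AnomalousDissipation.Theorems.SolenoidalFractalHomogenisation.LagrangianStep.Sideband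

open Set MeasureTheory NormedSpace
open scoped InnerProductSpace
open Literature.Analysis Literature.Analysis.FunctionSpaces Literature.Analysis.FunctionSpaces.Torus
open Literature.Analysis.FluidPDE Literature.Analysis.FluidPDE.Torus Literature.Analysis.FluidPDE.LatticeShear
open Summit.AnomalousDissipation.AnomalousDissipation.Theorems
open Summit.AnomalousDissipation.AnomalousDissipation.Theorems.SolenoidalFractalHomogenisation.LagrangianStep
open Summit.AnomalousDissipation.AnomalousDissipation.Theorems.SolenoidalFractalHomogenisation.LagrangianStep.CellChain (modeRep)
open Summit.AnomalousDissipation.AnomalousDissipation.Theorems.SolenoidalFractalHomogenisation.RealisedQuasiStaticCellLaw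
  (memLp_two_of_memSobolev_one_complexify memSobolev_one_singleMode isWeaklyDivFree_singleMode)

/-- Reassociation of the first term of the master estimate: `M·(2L·P₁·X) + B = M·(2L)·P₁·X + B` (the shape of
`…SidebandXSlowAveragingWeighted` versus the shape of `…SidebandXRepack.master_le_half_clause`). [folklore] -/
theorem master_reassoc (M L P X B : ℝ) : M * (2 * L * P * X) + B = M * (2 * L) * P * X + B := by ring

/-- **`stub_D1_V0R` (registered text, K1L_D skeleton v22–v26, ruling D27-1)**: the D1 residue certificate (clause (i), hypothesis) implies the guarded
slow-vector clause (ii) `SlowVectorClauseNoExF cubatureWord MB MB_pos c (ΨB₁ a) lo hi ΛV β σ C ν₀ K` for every normalisation `a > 0` with `c = 1/a`,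
`σ = 1`, `ν₀ = νB₁`, explicit `C, K`. [cite: MajdaKramer1999, §2.2.1.3 (55)] [cite: SandersVerhulstMurdock2007, Theorem 2.8.1 and Lemma 5.2.7] -/
theorem stub_D1_V0R :
    (∀ a > (0:ℝ), ∀ ν ∈ Set.Ioc 0 WCrossing.νB₁, ∀ S, Torus.NearIso S (10/11) (11/10) →
      ∀ τ ∈ Set.Icc (0:ℝ) (1/20), OddSectorial S τ →
        WCrossing.RelSmall (WCrossing.ΨB₁ a ν S - WCrossing.ΦB a S) (WCrossing.ΦB a S) WCrossing.ρB) →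
    ∀ a > (0:ℝ), ∃ c > (0:ℝ), ∀ lo hi ΛV β : ℝ, 0 < lo → lo ≤ hi → 1 < ΛV → 0 ≤ β → hi * ΛV ≤ 11/10 → 10/11 * ΛV ≤ lo → β * ΛV ≤ lo / 20 →
      ∃ σ > (0:ℝ), ∃ C : ℝ, 0 ≤ C ∧ ∃ ν₀ > (0:ℝ), ∃ K > (0:ℝ),
        SlowVectorClauseNoExF Summit.AnomalousDissipation.AnomalousDissipation.Theorems.cubatureWord WCrossing.MB WCrossing.MB_pos c (WCrossing.ΨB₁ a) lo hi ΛV β σ C ν₀ K := by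
  intro hres a ha
  refine ⟨1 / a, by positivity, ?_⟩
  intro lo hi ΛV β hlo hlh hΛ hβ h1 h2 hβΛ
  have hΛ0 : 0 < ΛV := by linarith only [hΛ]
  have hhi0 : 0 < hi := lt_of_lt_of_le hlo hlh
  -- ν-free constants (opaque where possible: no `set`-abstraction over the later, large context)
  obtain ⟨Cf₀, hCf₀⟩ : ∃ x : ℝ, x = xiCf cubatureWord := ⟨_, rfl⟩
  have hCf₀0 : 0 ≤ Cf₀ := by rw [hCf₀]; exact xiCf_nonneg _
  obtain ⟨AN, hAN⟩ : ∃ x : ℝ, x = 2 * Cf₀ * (1 + ΛV / (4 * Real.pi ^ 2 * lo)) := ⟨_, rfl⟩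
  have hAN0 : 0 ≤ AN := by rw [hAN]; positivity
  obtain ⟨hb₀, hhb₀⟩ : ∃ x : ℝ, x = hi * ΛV + β / 2 := ⟨_, rfl⟩
  have hhb₀0 : 0 ≤ hb₀ := by rw [hhb₀]; positivity
  set cψ : ℝ := (1 - WCrossing.ρB) * (97 / 100) * (3 / 10 * c0) / (11 / 10) with hcψ
  have hcψ0 : 0 < cψ := by
    have hρ : (0:ℝ) < 1 - WCrossing.ρB := by norm_num [WCrossing.ρB]
    have hc0 := c0_pos
    rw [hcψ]
    exact div_pos (mul_pos (mul_pos hρ (by norm_num)) (by positivity)) (by norm_num)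
  obtain ⟨H, hH⟩ : ∃ x : ℝ, x = hi * ΛV * (1 / a) := ⟨_, rfl⟩
  have hH0 : 0 < H := by rw [hH]; positivity
  obtain ⟨q, hq⟩ : ∃ x : ℝ, x = max 1 (cψ / (2 * H)) := ⟨_, rfl⟩
  have hq1 : 1 ≤ q := by rw [hq]; exact le_max_left _ _
  set P0 : ℝ := WCrossing.MB * cubatureWord.period with hP0
  have hP00 : 0 < P0 := mul_pos WCrossing.MB_pos (PermissibleCarrier.period_pos _)
  obtain ⟨s, hs⟩ : ∃ x : ℝ, x = Real.sqrt (4 * (ΛV / lo) ^ 2 / Real.pi ^ 2 *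
        ((32 * Real.pi ^ 2 * 534 ^ 2 + 192 * Real.pi ^ 2) * AN ^ 2 * hb₀ ^ 2 +
            24 * AN ^ 2 * (∑ j, 2 * Real.pi * ‖slotAmp cubatureWord j‖ * (5 + 3 * Real.sqrt (freqNormSq (cubatureWord.phase j).m))) ^ 2 / Real.pi ^ 2 +
          24 * AN ^ 4 * Cf₀ ^ 2 / Real.pi ^ 2 + 6 * (∑ j, 4 * Real.pi * ‖slotAmp cubatureWord j‖ / Real.sqrt (freqNormSq (cubatureWord.phase j).m)) ^ 2 / Real.pi ^ 2) +
      2048 * ((26 : ℕ) : ℝ) ^ 2 * (∑ j, ‖slotAmp cubatureWord j‖ ^ 2) ^ 2 * (∑ j, ‖slotAmp cubatureWord j‖) ^ 2 * (ΛV / lo) ^ 6 / Real.pi ^ 6) := ⟨_, rfl⟩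
  have hs0 : 0 ≤ s := by rw [hs]; exact Real.sqrt_nonneg _
  obtain ⟨C, hC1, hCA, hCB⟩ : ∃ C : ℝ, 1 ≤ C ∧
      2 * (Cf₀ * AN * (5 + (8 * Real.pi ^ 2 * hb₀ + 4 * Cf₀ * AN) / (4 * Real.pi ^ 2 * cψ)) / (4 * Real.pi ^ 2 * H) +
        (1 + 2 * Cf₀ * AN * P0) * (Cf₀ * AN * (ΛV / lo) / (Real.pi ^ 4 * H * P0))) ≤ C ∧
      2 * ((1 + 2 * Cf₀ * AN * P0) * (Cf₀ * q * (s + 2 * AN) / (4 * Real.pi ^ 2 * cψ))) ≤ C :=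
    ⟨max 1 (max _ _), le_max_left _ _, (le_max_left _ _).trans (le_max_right _ _), (le_max_right _ _).trans (le_max_right _ _)⟩
  obtain ⟨K, hK⟩ : ∃ x : ℝ, x = 3 + 96 * AN ^ 2 * Cf₀ ^ 2 * ΛV ^ 2 / (Real.pi ^ 4 * lo ^ 2) := ⟨_, rfl⟩
  have hKnn : 0 ≤ 96 * AN ^ 2 * Cf₀ ^ 2 * ΛV ^ 2 / (Real.pi ^ 4 * lo ^ 2) := by positivity
  have hKbig : 96 * AN ^ 2 * Cf₀ ^ 2 * ΛV ^ 2 / (Real.pi ^ 4 * lo ^ 2) ≤ K := by rw [hK]; linarith only [hKnn]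
  have hK3 : 3 ≤ K := by rw [hK]; linarith only [hKnn]
  have hK1 : 1 ≤ K := by linarith only [hK3]
  have hK0 : 0 < K := by linarith only [hK3]
  refine ⟨1, one_pos, C, by linarith only [hC1], WCrossing.νB₁, WCrossing.νB₁_pos, K, hK0, ?_⟩
  -- THE CLAUSE
  intro ν hν n 𝔸 hodd hwin ℓ hℓ0 hresol p hp1 hp T hT w v hw hv
  obtain ⟨lam, hlam, hN⟩ := hwin
  have hν0 : 0 < ν := hν.1
  have hν1 : ν ≤ 1 := hν.2.le.trans WCrossing.νB₁_le_one
  have hνB : ν ∈ Set.Ioc 0 WCrossing.νB₁ := ⟨hν.1, hν.2.le⟩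
  have hlam1 : 1 ≤ lam := hlam.1
  have hlam0 : 0 < lam := by linarith only [hlam1]
  -- the doubly stretched word and its ν-free data
  set W₁ : LatticeWord 26 := (cubatureWord.stretch WCrossing.MB WCrossing.MB_pos).stretch (1 / ν) (one_div_pos.mpr hν.1) with hW₁
  have hcell : cellField cubatureWord WCrossing.MB WCrossing.MB_pos ν hν.1 n = W₁.cell n := rfl
  have hCfW' : xiCf W₁ = xiCf cubatureWord := rfl
  have hCfW : xiCf W₁ = Cf₀ := hCfW'.trans hCf₀.symm
  have hP₁ : W₁.period = P0 / ν := period_stretch_stretch cubatureWord WCrossing.MB_pos hν0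
  -- window atoms
  have hl0 : 0 < ν * (lo / lam) := by positivity
  have hwinl : ν * (lo / ΛV) ≤ ν * (lo / lam) :=
    mul_le_mul_of_nonneg_left (div_le_div_of_nonneg_left hlo.le hlam0 hlam.2) hν0.le
  have hhiA : 0 ≤ ν * (hi * lam) := by positivity
  have hβA : 0 ≤ ν * β := by positivity
  have hhb : ν * (hi * lam) + ν * β / 2 ≤ ν * hb₀ := by
    have h3 : hi * lam ≤ hi * ΛV := mul_le_mul_of_nonneg_left hlam.2 hhi0.le
    have h4 : ν * (hi * lam) ≤ ν * (hi * ΛV) := mul_le_mul_of_nonneg_left h3 hν0.le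
    have e : ν * hb₀ = ν * (hi * ΛV) + ν * β / 2 := by rw [hhb₀]; ring
    rw [e]; linarith only [h4]
  -- the slow mode: ℓ, n, ξ, ξ'
  have hL2 : freqNormSq ℓ = ‖Torus.latticeVec ℓ‖ ^ 2 := freqNormSq_eq_norm_latticeVec_sq ℓ
  have hsq : Real.sqrt (freqNormSq ℓ) = ‖Torus.latticeVec ℓ‖ := by rw [hL2, Real.sqrt_sq (norm_nonneg _)]
  have hL1 : 1 ≤ ‖Torus.latticeVec ℓ‖ := by
    rw [← hsq, ← Real.sqrt_one]; exact Real.sqrt_le_sqrt (Torus.one_le_freqNormSq_of_ne_zero hℓ0)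
  have hL0 : 0 ≤ ‖Torus.latticeVec ℓ‖ := norm_nonneg _
  have hn : n ≠ 0 := n_ne_zero_of_res hL1 hK0 hν0 hresol
  have hn0 : (0:ℝ) < n := by exact_mod_cast Nat.pos_of_ne_zero hn
  have hℓn : 2 * Real.sqrt (freqNormSq ℓ) < n := by rw [hsq]; exact two_mul_lt_of_res hL1 hK3 hν0 hν1 hresol
  have hξ0 : 0 < ‖Torus.latticeVec ℓ‖ / n := by positivity
  have hξν : ‖Torus.latticeVec ℓ‖ / n ≤ ν * (‖Torus.latticeVec ℓ‖ * (⌈K / ν⌉₊ : ℝ) / n) := xi_le_nu_mul_xi' hL0 hK1 hν0 hn0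
  have hξ'1 : ‖Torus.latticeVec ℓ‖ * (⌈K / ν⌉₊ : ℝ) / n ≤ 1 := xi'_le_one hn0 hresol
  have hKξ : K * (‖Torus.latticeVec ℓ‖ / n) ≤ ν := K_mul_xi_le_nu hL0 hK0 hν0 hn0 hresol
  -- the box `R0 ν`
  have hR1 : 1 ≤ R0 ν := one_le_R0 hν0 hν1
  have hbox : ∀ j, (W₁.phase j).m ∈ box (R0 ν) := fun j => D1Tail.mem_box_cubature hν0 hν1 j
  have hMm : ∀ j i, |(W₁.phase j).m i| ≤ ((1 : ℕ) : ℤ) := fun j i => abs_m_cubature_le_one _ _ _ _ j i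
  have hRν : 1 ≤ ν ^ 3 * (R0 ν : ℝ) := nu_cube_mul_R0 hν0
  have hR0pos : (0:ℝ) < (R0 ν : ℝ) := by exact_mod_cast hR1
  -- the response size
  have hCN0 : 0 ≤ xiCN W₁ (ν * (lo / lam)) := xiCN_nonneg W₁ hl0
  have hCN : xiCN W₁ (ν * (lo / lam)) ≤ AN / ν := by
    have h := xiCN_le_of_window W₁ hl0 hν0 hν1 hlo hΛ0 hwinl
    rwa [hCfW, ← hAN] at h
  -- the datum
  have hF2 : MemLp (fun x => (UnitAddTorus.mFourier ℓ x).re • p) 2 volume :=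
    memLp_two_of_memSobolev_one_complexify (memSobolev_one_singleMode ℓ p)
  have hFi : Integrable (fun x => (UnitAddTorus.mFourier ℓ x).re • p) volume := hF2.integrable one_le_two
  have hFdiv := isWeaklyDivFree_singleMode ℓ hp
  set E0 : ℝ := ∫ x, ‖(UnitAddTorus.mFourier ℓ x).re • p‖ ^ 2 with hE0
  have hE00 : 0 ≤ E0 := integral_nonneg fun x => sq_nonneg _
  -- the cell solution
  rw [hcell] at hw
  have h𝔹 : Torus.NearIso ((1 / (n:ℝ) ^ 2) • 𝔸) (1 / (n:ℝ) ^ 2 * (ν * (lo / lam))) (1 / (n:ℝ) ^ 2 * (ν * (hi * lam))) := hN.smul (by positivity)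
  have hxM : ∀ s' ∈ Icc 0 T, ‖modeRep W₁ n ((1 / (n:ℝ) ^ 2) • 𝔸) (fun x => (UnitAddTorus.mFourier ℓ x).re • p) w ℓ s'‖ ≤ Real.sqrt E0 :=
    fun s' hs' => norm_modeRep_le_sqrt_energy W₁ hn hT h𝔹 (by positivity) hF2 hFdiv hw ℓ hs'
  have hE0M : E0 ≤ Real.sqrt E0 ^ 2 := (Real.sq_sqrt hE00).ge
  -- the effective solution and the generator
  rw [effTensor_eq ha hν0 n 𝔸] at hv
  have hfn0 : 0 < freqNormSq ℓ := lt_of_lt_of_le one_pos (Torus.one_le_freqNormSq_of_ne_zero hℓ0)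
  obtain ⟨r₁, hr₁⟩ : ∃ x : ℝ, x = 4 * Real.pi ^ 2 * (1 / (n : ℝ) ^ 2 * (ν * (lo / lam) + cψ / ν)) * freqNormSq ℓ := ⟨_, rfl⟩
  have hr₁0 : 0 < r₁ := by rw [hr₁]; positivity
  set G := effGenC ((1 / (n : ℝ) ^ 2) • (𝔸 + (1 / ν) • Sideband.psiStar cubatureWord WCrossing.MB WCrossing.MB_pos ν ((1 / ν) • 𝔸))) ℓ r₁ with hG
  have hcoer : ∀ z : EuclideanSpace ℂ (Fin 3), r₁ * ‖z‖ ^ 2 ≤ ⟪G z, z⟫_ℝ := by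
    intro z
    have h : 4 * Real.pi ^ 2 * (1 / (n : ℝ) ^ 2 * (ν * (lo / lam) + cψ / ν)) * freqNormSq ℓ * ‖z‖ ^ 2 ≤
        ⟪effGenC ((1 / (n : ℝ) ^ 2) • (𝔸 + (1 / ν) • Sideband.psiStar cubatureWord WCrossing.MB WCrossing.MB_pos ν ((1 / ν) • 𝔸))) ℓ
            (4 * Real.pi ^ 2 * (1 / (n : ℝ) ^ 2 * (ν * (lo / lam) + cψ / ν)) * freqNormSq ℓ) z, z⟫_ℝ :=
      effGenC_clause_coercive ha (hres a ha) hlo hlh h1 h2 hβ hβΛ hlam hνB hN hodd n ℓ z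
    rwa [← hr₁] at h
  have hGx : ∀ z : EuclideanSpace ℂ (Fin 3), transversalProj ℓ z = z →
      G z = (((4 * Real.pi ^ 2 : ℝ) : ℂ)) • transversalProj ℓ (Torus.symbT (Torus.majorTranspose ((1 / (n : ℝ) ^ 2) • 𝔸)) ℓ z) +
        slowMean W₁ n ℓ 𝔸 (R0 ν) z := by
    intro z hz
    have h := effGenC_clause_apply_of_transversal cubatureWord WCrossing.MB WCrossing.MB_pos hν.1 hN hl0 hn ℓ r₁ hz
    rw [hG, hW₁]
    exact h
  have hGn : ‖G‖ ≤ 4 * Real.pi ^ 2 * (Real.sqrt (freqNormSq ℓ) / n) ^ 2 * (ν * hb₀) +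
      (Real.sqrt (freqNormSq ℓ) / n) ^ 2 * xiCf W₁ * xiCN W₁ (ν * (lo / lam)) + 2 * r₁ := by
    have h := norm_effGenC_clause_le cubatureWord WCrossing.MB WCrossing.MB_pos hν.1 hN hl0 hhiA hodd hβA hhb hn ℓ hr₁0.le
    rw [hG, hW₁]
    exact h
  -- the smallness input of the residual sup bound
  have hsmall : 2 * (12 * (xiCN W₁ (ν * (lo / lam)) * xiCf W₁) ^ 2 / (Real.pi ^ 2 * (ν * (lo / lam)))) * (Real.sqrt (freqNormSq ℓ) / n) ^ 4 ≤
      Real.pi ^ 2 * (ν * (lo / lam)) / 4 := by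
    rw [hCfW, hsq]; exact hsmall_of_window hν0 hlo hΛ0 hwinl hξ0.le hK1 hKξ hCN0 hCN hCf₀0 hKbig
  -- `s` in the slot data of `W₁` (definitionally the slot data of the cubature word)
  have hsW : Real.sqrt (4 * (ΛV / lo) ^ 2 / Real.pi ^ 2 *
        ((32 * Real.pi ^ 2 * 534 ^ 2 + 192 * Real.pi ^ 2) * AN ^ 2 * hb₀ ^ 2 +
            24 * AN ^ 2 * (∑ j, 2 * Real.pi * ‖slotAmp W₁ j‖ * (5 + 3 * Real.sqrt (freqNormSq (W₁.phase j).m))) ^ 2 / Real.pi ^ 2 +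
          24 * AN ^ 4 * Cf₀ ^ 2 / Real.pi ^ 2 + 6 * (∑ j, 4 * Real.pi * ‖slotAmp W₁ j‖ / Real.sqrt (freqNormSq (W₁.phase j).m)) ^ 2 / Real.pi ^ 2) +
      2048 * ((26 : ℕ) : ℝ) ^ 2 * (∑ j, ‖slotAmp W₁ j‖ ^ 2) ^ 2 * (∑ j, ‖slotAmp W₁ j‖) ^ 2 * (ΛV / lo) ^ 6 / Real.pi ^ 6) = s := by
    rw [hs]; rfl
  -- THE MASTER ESTIMATE at every `t ∈ [0,T]`
  have hmaster : ∀ t ∈ Icc 0 T,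
      ‖modeRep W₁ n ((1 / (n:ℝ) ^ 2) • 𝔸) (fun x => (UnitAddTorus.mFourier ℓ x).re • p) w ℓ t -
          exp (-(t • G)) (modeRep W₁ n ((1 / (n:ℝ) ^ 2) • 𝔸) (fun x => (UnitAddTorus.mFourier ℓ x).re • p) w ℓ 0)‖ ≤
        Real.sqrt E0 * (C * (C * (ν + ‖Torus.latticeVec ℓ‖ * (⌈K / ν⌉₊ : ℝ) / n) *
          min 1 (8 * Real.pi ^ 2 * ‖Torus.latticeVec ℓ‖ ^ 2 * (hi * ΛV) * (ν + 1 / a / ν) / (n:ℝ) ^ 2 * t) +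
            8 * Real.pi ^ 2 * ‖Torus.latticeVec ℓ‖ ^ 2 * (hi * ΛV) * (ν + 1 / a / ν) / (n:ℝ) ^ 2 * (P0 / ν)) / 2) := by
    intro t ht
    have hav := norm_modeRep_sub_exp_le_weighted W₁ hN hl0 hw hFi hbox G hr₁0 hcoer le_rfl hGx ht (fun s' hs' => hxM s' ⟨hs'.1, hs'.2.trans ht.2⟩)
    have hbud := forcing_integral_le_single W₁ hl0 hhiA hβA hn hT hN hodd hℓ0 hℓn hp hw hR1 hR1 hMm hxM hE0M hsmall hr₁0 ht
    have hpre0 : 0 ≤ 1 + 2 * ((Real.sqrt (freqNormSq ℓ) / n) ^ 2 * (∑ j, 4 * Real.pi * ‖slotAmp W₁ j‖) *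
        (∑ j, 8 * Real.pi * ‖slotAmp W₁ j‖ / min 1 (4 * Real.pi ^ 2 * (ν * (lo / lam))))) * W₁.period := by
      have := PermissibleCarrier.period_pos W₁
      have : 0 ≤ (∑ j, 8 * Real.pi * ‖slotAmp W₁ j‖ / min 1 (4 * Real.pi ^ 2 * (ν * (lo / lam)))) := by rw [← xiCN_def]; exact hCN0
      positivity
    have hstep := hav.trans (add_le_add le_rfl (mul_le_mul_of_nonneg_left hbud hpre0))
    -- normalise the atoms: `xiCf W₁ = Cf₀`, `P₁ = P₀/ν`, `√|ℓ|² = ‖ℓ‖`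
    rw [← xiCf_def, ← xiCN_def, hP₁, hsq, hCfW, master_reassoc] at hstep
    have hGn' := hGn
    rw [hsq, hCfW] at hGn'
    have hS := sqrt_rho_le (ξ := ‖Torus.latticeVec ℓ‖ / n) (ξ' := ‖Torus.latticeVec ℓ‖ * (⌈K / ν⌉₊ : ℝ) / n)
      (D₁ := ∑ j, 2 * Real.pi * ‖slotAmp W₁ j‖ * (5 + 3 * Real.sqrt (freqNormSq (W₁.phase j).m)))
      (D₂ := ∑ j, 4 * Real.pi * ‖slotAmp W₁ j‖ / Real.sqrt (freqNormSq (W₁.phase j).m))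
      (A₂ := ∑ j, ‖slotAmp W₁ j‖ ^ 2) (Cs := ∑ j, ‖slotAmp W₁ j‖) (k := ((26 : ℕ) : ℝ))
      hν0 hν1 hlo hΛ0 hl0 hwinl hξ0.le hξν hξ'1 (by positivity : 0 ≤ ν * (hi * lam) + ν * β / 2) hhb hCN0 hCN hCf₀0
      (Finset.sum_nonneg fun j _ => sq_nonneg _) (by positivity) hR0pos hRν
    rw [hsW] at hS
    have hrlo_ge : 4 * Real.pi ^ 2 * cψ * (‖Torus.latticeVec ℓ‖ / n) ^ 2 / ν ≤ r₁ := by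
      rw [hr₁, hL2]
      have h0 : 0 ≤ 4 * Real.pi ^ 2 * (‖Torus.latticeVec ℓ‖ ^ 2 / (n:ℝ) ^ 2) * (ν * (lo / lam)) := by positivity
      rw [show 4 * Real.pi ^ 2 * (1 / (n:ℝ) ^ 2 * (ν * (lo / lam) + cψ / ν)) * ‖Torus.latticeVec ℓ‖ ^ 2 =
        4 * Real.pi ^ 2 * (‖Torus.latticeVec ℓ‖ ^ 2 / (n:ℝ) ^ 2) * (ν * (lo / lam)) +
          4 * Real.pi ^ 2 * cψ * (‖Torus.latticeVec ℓ‖ / n) ^ 2 / ν by field_simp]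
      exact le_add_of_nonneg_left h0
    have hrbar : 8 * Real.pi ^ 2 * H * (‖Torus.latticeVec ℓ‖ / n) ^ 2 / ν ≤
        8 * Real.pi ^ 2 * ‖Torus.latticeVec ℓ‖ ^ 2 * (hi * ΛV) * (ν + 1 / a / ν) / (n:ℝ) ^ 2 := by
      rw [hH]
      have h0 : 0 ≤ 8 * Real.pi ^ 2 * ‖Torus.latticeVec ℓ‖ ^ 2 * (hi * ΛV) * ν / (n:ℝ) ^ 2 := by positivity
      rw [show 8 * Real.pi ^ 2 * ‖Torus.latticeVec ℓ‖ ^ 2 * (hi * ΛV) * (ν + 1 / a / ν) / (n:ℝ) ^ 2 =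
        8 * Real.pi ^ 2 * ‖Torus.latticeVec ℓ‖ ^ 2 * (hi * ΛV) * ν / (n:ℝ) ^ 2 +
          8 * Real.pi ^ 2 * (hi * ΛV * (1 / a)) * (‖Torus.latticeVec ℓ‖ / n) ^ 2 / ν by field_simp]
      exact le_add_of_nonneg_left h0
    have hrq : r₁ ≤ q * (8 * Real.pi ^ 2 * ‖Torus.latticeVec ℓ‖ ^ 2 * (hi * ΛV) * (ν + 1 / a / ν) / (n:ℝ) ^ 2) := by
      rw [hr₁, hL2]
      have hq2 : cψ ≤ 2 * q * H := by
        have h5 : cψ / (2 * H) ≤ q := by rw [hq]; exact le_max_right _ _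
        rw [div_le_iff₀ (by positivity)] at h5
        linarith only [h5]
      have h4 : lo ≤ hi * ΛV := hlh.trans (le_mul_of_one_le_right hhi0.le hΛ.le)
      have hlo' : lo / lam ≤ 2 * q * (hi * ΛV) :=
        ((div_le_self hlo.le hlam1).trans h4).trans (le_mul_of_one_le_left (by positivity) (by linarith only [hq1]))
      have hx : 0 ≤ 4 * Real.pi ^ 2 * (‖Torus.latticeVec ℓ‖ ^ 2 / (n:ℝ) ^ 2) := by positivity
      have e1 : 4 * Real.pi ^ 2 * (1 / (n:ℝ) ^ 2 * (ν * (lo / lam) + cψ / ν)) * ‖Torus.latticeVec ℓ‖ ^ 2 =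
          4 * Real.pi ^ 2 * (‖Torus.latticeVec ℓ‖ ^ 2 / (n:ℝ) ^ 2) * (ν * (lo / lam) + cψ / ν) := by ring
      have e2 : q * (8 * Real.pi ^ 2 * ‖Torus.latticeVec ℓ‖ ^ 2 * (hi * ΛV) * (ν + 1 / a / ν) / (n:ℝ) ^ 2) =
          4 * Real.pi ^ 2 * (‖Torus.latticeVec ℓ‖ ^ 2 / (n:ℝ) ^ 2) * (ν * (2 * q * (hi * ΛV)) + 2 * q * H / ν) := by
        rw [hH]; field_simp; ring
      rw [e1, e2]
      refine mul_le_mul_of_nonneg_left (add_le_add (mul_le_mul_of_nonneg_left hlo' hν0.le) ?_) hx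
      exact div_le_div_of_nonneg_right hq2 hν0.le
    have hhalf := master_le_half_clause (M := Real.sqrt E0) (t := t) hν0 hν1 hξ0 hξν hξ'1 hCf₀0 hCN0 hCN (Real.sqrt_nonneg _)
      hl0 hlo hΛ0 hwinl hP00 rfl hhb₀0 hGn' hr₁0 hcψ0 hrlo_ge hq1 hrq hH0 hrbar ht.1 (Real.sqrt_nonneg _) hs0 hS hC1 hCA hCB
    exact hstep.trans hhalf
  -- THE CLAUSE INEQUALITY, a.e.
  have hcur := ae_two_sum_modeCoeff_sub_eq W₁ n hT (by linarith only [hT] : T ≤ 2 * T) hℓ0 hp hw hv r₁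
  filter_upwards [hcur, ae_restrict_mem measurableSet_Ioo] with t hct ht
  rw [hct, Real.rpow_one, Real.rpow_one, ← hP0]
  exact two_mul_sq_le_of_le_half (norm_nonneg _) hE00 (hmaster t ⟨ht.1.le, ht.2.le⟩)

end Summit.AnomalousDissipation.AnomalousDissipation.Theorems.SolenoidalFractalHomogenisation.LagrangianStep.Sideband

end
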